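import Literature.NumberTheory.GelbartRogawski1991.LocalDoubledUnitarySmoothSplit
import Literature.NumberTheory.Automorphic.GLIntegralBigCellWitness
import Literature.RepresentationTheory.HeisenbergGroup.ImplementerOmegaEigen
import HarnessLib

-- buildfix G11b-3 recipe (LEDGER B13-1/B13-3): elaborate sequentially so the trailing `attribute [implicit_reducible]`
-- block (reducibilityCoreExt is keyed to the async environment branch) is in force at `.olean` export.
set_option Elab.async false

/-!
# The unramified clause for the doubled unitary group, IV: the integral big-cell argument at a SPLIT place
# ([GelbartRogawski1991, §3.1 (3.1.3)]; [Kudla1994, §3]; [MoeglinVignerasWaldspurger1987, Chap. 2 II.10])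

Topic `NumberTheory/GelbartRogawski1991`; namespace
`Literature.NumberTheory.GelbartRogawski1991.UnitaryDualPair.LocalSplitting` (sequel of `LocalDoubledUnitarySmoothSplit` and
`Automorphic/GLIntegralBigCellWitness`).  KERNEL only; no named fact, no `sorry`.

At a place `v` of `F` that SPLITS in `E` (`c w ≠ w` over `v`) the doubled unitary group is `H(F_v) ≅ GL_{n+n}(E_w)` (the
`w`-component, tree `localPiSplitEquiv` ∕ `splitEquivD`), `H(𝒪_v) ≅ GL_{n+n}(𝒪_w)` when `T₀ ∈ GL_n(𝒪_w)`
(`localPiSplitEquiv_symm_mem_localInt_iff`), the Siegel parabolic `P_Δ` is the block-upper-triangular group of the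
`Δ`-adapted frame and its unipotent radical is ALL of `{n(y) = R [[1, y], [0, 1]] R⁻¹ : y ∈ M_n(E_w)}` (no skewness
constraint at a split place).  We prove the split-place twin of `LocalDoubledUnitaryUnramifiedCell`:
* §1 the elements `nSplit y ∈ P_Δ(F_v) ∩ H(𝒪_v)` (`y` integral, `|2|_w = 1`) and `weylSplit ∈ H(𝒪_v)`;
* §2 **the integral big-cell decomposition** `w n(y) k = p · (w n(−ν))` inside `H(𝒪_v)` for `k ∈ H(𝒪_v)` and an
  integral `y` with `A_k + y C_k ∈ GL_n(𝒪_w)` (`exists_bigCell_relation_split`);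
* §3 **the unramified clause, group-theoretic form** (`omega_eq_self_of_glWitness_split`): if `Φ₀ ≠ 0` is an
  eigenvector of `ω(w)`, and `P_Δ(F_v) ∩ H(𝒪_v)` fixes `Φ₀` under `ω = β⁻¹ · r ∘ ι`, then ALL of `H(𝒪_v)` fixes `Φ₀` — the
  residue witness being `GLBigCell.exists_integral_valuation_det_block₁₁_add_mul_eq_one` (reduction of `GL_{2n}(𝒪_w)`
  modulo `𝔭_w` and the field fact that every invertible `[[a, b], [c, d]]` has some `a + y c` invertible).
Stage-1 cell `pub-hodgecm`, seat GR-1, brick L7s of the [GelbartRogawski1991, Prop. 3.1.1] kernel construction.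
-/

set_option autoImplicit false

noncomputable section

open NumberField IsDedekindDomain Matrix
open scoped ValuativeRel
open Literature.NumberTheory.Automorphic Literature.NumberTheory.Automorphic.UnitaryGroup
open Literature.NumberTheory.GelbartRogawski1991.AdaptedBlocks
open Literature.RepresentationTheory.HeisenbergGroup
open Literature.NumberTheory.Automorphic.IntegralReduction

namespace Literature.NumberTheory.GelbartRogawski1991.UnitaryDualPair.LocalSplitting

variable (F : Type) [Field F] [NumberField F] (E : Type) [Field E] [NumberField E] [Algebra F E]
  [Algebra.IsQuadraticExtension F E] (c : E ≃ₐ[F] E)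
  {δ : E} (hcδ : c δ = -δ) (hδ : δ ≠ 0) {d : F} (hd : δ * δ = algebraMap F E d)
  (v : HeightOneSpectrum (𝓞 F)) (n : ℕ) {T₀ : Matrix (Fin n) (Fin n) F} (hT₀ : T₀.IsSymm) (hT₀d : IsUnit T₀.det)
  {JD : Matrix (Fin (n + n)) (Fin (n + n)) E} (hJD : JD = (gramD F n T₀).map (algebraMap F E))
  (w : PlacesOver E v) (hw : c • w.1 ≠ w.1)

/-! ## §0 Re-enumeration bookkeeping -/

omit [Algebra.IsQuadraticExtension F E] in
/-- re-enumeration (inverse direction) is multiplicative. [cite: Kudla1994, §3] -/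
private theorem reindex_symm_mul' {K : Type*} [CommRing K] (M N : Matrix (Fin (n + n)) (Fin (n + n)) K) :
    Matrix.reindex (e₂ n).symm (e₂ n).symm (M * N) =
      Matrix.reindex (e₂ n).symm (e₂ n).symm M * Matrix.reindex (e₂ n).symm (e₂ n).symm N := by
  rw [Matrix.reindex_apply, Matrix.reindex_apply, Matrix.reindex_apply, Matrix.submatrix_mul_equiv]

omit [Algebra.IsQuadraticExtension F E] in
/-- `reindex⁻¹ ∘ reindex = id`. [cite: Kudla1994, §3] -/
private theorem reindex_symm_reindex' {K : Type*} (M : Matrix (Fin n ⊕ Fin n) (Fin n ⊕ Fin n) K) :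
    Matrix.reindex (e₂ n).symm (e₂ n).symm (Matrix.reindex (e₂ n) (e₂ n) M) = M := by
  rw [Matrix.reindex_apply, Matrix.reindex_apply, Matrix.submatrix_submatrix, Equiv.symm_symm, Equiv.symm_comp_self,
    Matrix.submatrix_id_id]

omit [Algebra.IsQuadraticExtension F E] in
/-- `matW` is multiplicative. [cite: Kudla1994, §3] -/
theorem matW_mul (g h : UnitaryGroup.localPi E c (n + n) JD v) :
    matW F E c v n w (g * h) = matW F E c v n w g * matW F E c v n w h := by
  rw [matW, matW, matW, Subgroup.coe_mul, Pi.mul_apply, Units.val_mul, reindex_symm_mul']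

omit [Algebra.IsQuadraticExtension F E] in
/-- `matW 1 = 1`. [cite: Kudla1994, §3] -/
theorem matW_one : matW F E c v n w (1 : UnitaryGroup.localPi E c (n + n) JD v) = 1 := by
  rw [matW, Subgroup.coe_one, Pi.one_apply, Units.val_one, Matrix.reindex_apply, Matrix.submatrix_one_equiv]

/-! ## §1 The elements `n(y)`, `w` at a split place -/

/-- the unipotent `[[1, y], [0, 1]]` of `GL_{n+n}(E_w)`, re-enumerated. [cite: Kudla1994, §3] -/
def unipW (y : Matrix (Fin n) (Fin n) (w.1.adicCompletion E)) : GL (Fin (n + n)) (w.1.adicCompletion E) :=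
  ⟨Matrix.reindex (e₂ n) (e₂ n) (Matrix.fromBlocks 1 y 0 1), Matrix.reindex (e₂ n) (e₂ n) (Matrix.fromBlocks 1 (-y) 0 1),
    by
      rw [Matrix.reindex_apply, Matrix.reindex_apply, Matrix.submatrix_mul_equiv, Matrix.fromBlocks_multiply]
      simp [Matrix.fromBlocks_one],
    by
      rw [Matrix.reindex_apply, Matrix.reindex_apply, Matrix.submatrix_mul_equiv, Matrix.fromBlocks_multiply]
      simp [Matrix.fromBlocks_one]⟩

omit [NumberField F] [Algebra.IsQuadraticExtension F E] in
/-- underlying matrix of `unipW y`. [cite: Kudla1994, §3] -/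
@[simp] theorem coe_unipW (y : Matrix (Fin n) (Fin n) (w.1.adicCompletion E)) :
    ((unipW F E v n w y : GL (Fin (n + n)) (w.1.adicCompletion E)) : Matrix (Fin (n + n)) (Fin (n + n)) (w.1.adicCompletion E)) =
      Matrix.reindex (e₂ n) (e₂ n) (Matrix.fromBlocks 1 y 0 1) := rfl

omit [NumberField F] [Algebra.IsQuadraticExtension F E] in
/-- `unipW y · unipW (−y) = 1`. [cite: Kudla1994, §3] -/
theorem unipW_mul_unipW_neg (y : Matrix (Fin n) (Fin n) (w.1.adicCompletion E)) :
    unipW F E v n w y * unipW F E v n w (-y) = 1 :=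
  Units.ext (unipW F E v n w y).val_inv

include hcδ hδ hT₀ hT₀d hJD in
/-- **`n(y) ∈ H(F_v)` at a split place**: `w`-component `R · [[1, y], [0, 1]] · R⁻¹`. [cite: Kudla1994, §3] -/
def nSplit (y : Matrix (Fin n) (Fin n) (w.1.adicCompletion E)) : UnitaryGroup.localPi E c (n + n) JD v :=
  (splitEquivD F E c hcδ hδ v n hT₀ hT₀d hJD w hw).symm
    (toGLw F E v n w (cayGL F E v n) * unipW F E v n w y * (toGLw F E v n w (cayGL F E v n))⁻¹)

/-- `adapt (matW (nSplit y)) = [[1, y], [0, 1]]`. [cite: Kudla1994, §3] -/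
theorem adapt_matW_nSplit (y : Matrix (Fin n) (Fin n) (w.1.adicCompletion E)) :
    adapt (matW F E c v n w (nSplit F E c hcδ hδ v n hT₀ hT₀d hJD w hw y)) = Matrix.fromBlocks 1 y 0 1 := by
  rw [matW, nSplit, splitEquivD_symm_apply_w, Units.val_mul, Units.val_mul, coe_toGLw_cayGL, coe_toGLw_cayGL_inv, coe_unipW,
    reindex_symm_mul', reindex_symm_mul', reindex_symm_reindex', reindex_symm_reindex', reindex_symm_reindex', adapt_conj]

/-- `adapt (matW w_Δ) = antidiag(1, 1)`. [cite: Kudla1994, §3] -/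
theorem adapt_matW_weylSplit :
    adapt (matW F E c v n w (weylSplit F E c hcδ hδ v n hT₀ hT₀d hJD w hw)) =
      Matrix.fromBlocks (0 : Matrix (Fin n) (Fin n) (w.1.adicCompletion E)) 1 1 0 := by
  rw [matW, weylSplit, splitEquivD_symm_apply_w, Units.val_mul, Units.val_mul, coe_toGLw_cayGL, coe_toGLw_cayGL_inv,
    coe_toGLw_weylGL, reindex_symm_mul', reindex_symm_mul', reindex_symm_reindex', reindex_symm_reindex',
    reindex_symm_reindex', adapt_conj]

/-- `n(y) ∈ P_Δ(F_v)`. [cite: Kudla1994, §3] -/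
theorem isSiegelDelta_nSplit (y : Matrix (Fin n) (Fin n) (w.1.adicCompletion E)) :
    IsSiegelDelta F E c hcδ hδ hd v n hT₀ hJD (nSplit F E c hcδ hδ v n hT₀ hT₀d hJD w hw y) := by
  refine isSiegelDelta_of_blkC_matW_eq_zero F E c hcδ hδ hd v n hT₀ hT₀d hJD w hw ?_
  rw [blkC_eq_adapt_toBlocks₂₁, adapt_matW_nSplit, Matrix.toBlocks_fromBlocks₂₁]

/-- `n(y) n(−y) = 1`. [cite: Kudla1994, §3] -/
theorem nSplit_mul_nSplit_neg (y : Matrix (Fin n) (Fin n) (w.1.adicCompletion E)) :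
    nSplit F E c hcδ hδ v n hT₀ hT₀d hJD w hw y * nSplit F E c hcδ hδ v n hT₀ hT₀d hJD w hw (-y) = 1 := by
  rw [nSplit, nSplit, ← _root_.map_mul]
  have : toGLw F E v n w (cayGL F E v n) * unipW F E v n w y * (toGLw F E v n w (cayGL F E v n))⁻¹ *
      (toGLw F E v n w (cayGL F E v n) * unipW F E v n w (-y) * (toGLw F E v n w (cayGL F E v n))⁻¹) = 1 := by
    calc _ = toGLw F E v n w (cayGL F E v n) * (unipW F E v n w y * unipW F E v n w (-y)) * (toGLw F E v n w (cayGL F E v n))⁻¹ := by group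
      _ = 1 := by rw [unipW_mul_unipW_neg, mul_one, mul_inv_cancel]
  rw [this, map_one]

/-- `w_Δ w_Δ = 1` at a split place. [cite: Kudla1994, §3] -/
theorem weylSplit_mul_self :
    weylSplit F E c hcδ hδ v n hT₀ hT₀d hJD w hw * weylSplit F E c hcδ hδ v n hT₀ hT₀d hJD w hw = 1 := by
  rw [weylSplit, ← _root_.map_mul]
  have : toGLw F E v n w (cayGL F E v n) * toGLw F E v n w (weylGL F E v n) * (toGLw F E v n w (cayGL F E v n))⁻¹ *
      (toGLw F E v n w (cayGL F E v n) * toGLw F E v n w (weylGL F E v n) * (toGLw F E v n w (cayGL F E v n))⁻¹) = 1 := by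
    calc _ = toGLw F E v n w (cayGL F E v n) * (toGLw F E v n w (weylGL F E v n) * toGLw F E v n w (weylGL F E v n)) *
        (toGLw F E v n w (cayGL F E v n))⁻¹ := by group
      _ = 1 := by rw [toGLw_weylGL_mul_self, mul_one, mul_inv_cancel]
  rw [this, map_one]

/-! ### Integral points: `H(𝒪_v) = GL_{n+n}(𝒪_w)` at a split place of good reduction -/

section Integral

variable (hTw : ∀ i j, ValuativeRel.valuation (w.1.adicCompletion E) (gramW F E v n (T₀ := T₀) w i j) ≤ 1)
  (hTwd : ValuativeRel.valuation (w.1.adicCompletion E) (gramW F E v n (T₀ := T₀) w).det = 1)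
  (h2 : ValuativeRel.valuation (w.1.adicCompletion E) (2 : w.1.adicCompletion E) = 1)

include hTw hTwd hJD in
omit [Algebra.IsQuadraticExtension F E] in
/-- `J_w ∈ GL_{n+n}(𝒪_w)` when `T₀ ∈ GL_n(𝒪_w)`. [cite: PlatonovRapinchuk1994, §5.1] -/
theorem placeFormD_unit_mem_glInt :
    (isUnit_placeFormD F E v n hT₀d hJD w).unit ∈ glInt (n + n) (w.1.adicCompletion E) := by
  have hJ : ValBound 1 (placeForm JD w.1) := by
    rw [placeForm_eq F E v n hJD w]
    intro i j
    simp only [Matrix.reindex_apply, Matrix.submatrix_apply]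
    rcases (e₂ n).symm i with a | a <;> rcases (e₂ n).symm j with b | b
    · exact hTw a b
    · simp
    · simp
    · simp only [Matrix.fromBlocks_apply₂₂, Matrix.neg_apply, Valuation.map_neg]; exact hTw a b
  have hJd : ValuativeRel.valuation (w.1.adicCompletion E) (placeForm JD w.1).det = 1 := by
    rw [placeForm_eq F E v n hJD w, Matrix.det_reindex_self, Matrix.det_fromBlocks_zero₂₁, Matrix.det_neg, _root_.map_mul,
      _root_.map_mul, map_pow, Valuation.map_neg, _root_.map_one, one_pow, one_mul, hTwd, mul_one]
  rw [mem_glInt_iff]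
  refine ⟨fun i j => (Valuation.mem_integer_iff _ _).2 (hJ i j), fun i j => (Valuation.mem_integer_iff _ _).2 ?_⟩
  rw [Matrix.coe_units_inv, IsUnit.unit_spec]
  exact DoubledUnitary.valBound_one_nonsing_inv hJ hJd i j

include hTw hTwd in
/-- **`H(𝒪_v) ∋ e⁻¹ g ⟺ g ∈ GL_{n+n}(𝒪_w)`** for the split-place identification `e = splitEquivD`. [cite: PlatonovRapinchuk1994, §5.1] -/
theorem splitEquivD_symm_mem_localInt_iff (g : GL (Fin (n + n)) (w.1.adicCompletion E)) :
    (splitEquivD F E c hcδ hδ v n hT₀ hT₀d hJD w hw).symm g ∈ UnitaryGroup.localInt E c (n + n) JD v ↔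
      g ∈ glInt (n + n) (w.1.adicCompletion E) := by
  unfold splitEquivD
  exact localPiSplitEquiv_symm_mem_localInt_iff c JD (galConj_ne_one_of_delta F E c hcδ hδ) (hermD_conj_transpose F E c n hT₀ hJD) w hw
    (isUnit_placeFormD F E v n hT₀d hJD w) (placeFormD_unit_mem_glInt F E v n hT₀d hJD w hTw hTwd) g

omit [NumberField F] [Algebra.IsQuadraticExtension F E] in
/-- an invertible matrix with integral entries and integral inverse entries is in `GL(𝒪_w)`. [cite: PlatonovRapinchuk1994, §5.1] -/
theorem mem_glInt_of_valBound {g : GL (Fin (n + n)) (w.1.adicCompletion E)}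
    (h1 : ValBound 1 (g : Matrix (Fin (n + n)) (Fin (n + n)) (w.1.adicCompletion E)))
    (h2' : ValBound 1 ((g⁻¹ : GL (Fin (n + n)) (w.1.adicCompletion E)) : Matrix (Fin (n + n)) (Fin (n + n)) (w.1.adicCompletion E))) :
    g ∈ glInt (n + n) (w.1.adicCompletion E) :=
  (mem_glInt_iff g).2 ⟨fun i j => (Valuation.mem_integer_iff _ _).2 (h1 i j), fun i j => (Valuation.mem_integer_iff _ _).2 (h2' i j)⟩

omit [NumberField F] [Algebra.IsQuadraticExtension F E] in
/-- re-enumeration preserves integrality. [cite: PlatonovRapinchuk1994, §5.1] -/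
theorem valBound_reindex {M : Matrix (Fin n ⊕ Fin n) (Fin n ⊕ Fin n) (w.1.adicCompletion E)} (hM : ValBound 1 M) :
    ValBound 1 (Matrix.reindex (e₂ n) (e₂ n) M) := fun _ _ => hM _ _

include h2 in
omit [Algebra.IsQuadraticExtension F E] in
/-- `R_w ∈ GL(𝒪_w)` when `|2|_w = 1`. [cite: HarrisKudlaSweet1996, §1 (1.11)] -/
theorem toGLw_cayGL_mem_glInt :
    toGLw F E v n w (cayGL F E v n) ∈ glInt (n + n) (w.1.adicCompletion E) := by
  have hR : ValBound 1 (cayR (w.1.adicCompletion E) (Fin n)) := by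
    rintro (i | i) (j | j)
    all_goals
      by_cases h : i = j
      · subst h; simp [cayR]
      · simp [cayR, Matrix.one_apply_ne h]
  have hRi : ValBound 1 (cayRinv (w.1.adicCompletion E) (Fin n)) := by
    intro i j
    rw [cayRinv, Matrix.smul_apply, smul_eq_mul, _root_.map_mul]
    have : ValuativeRel.valuation (w.1.adicCompletion E) (⅟(2 : w.1.adicCompletion E)) = 1 := by
      have h := congrArg (ValuativeRel.valuation (w.1.adicCompletion E)) (invOf_mul_self (2 : w.1.adicCompletion E))
      rw [_root_.map_mul, h2, mul_one, _root_.map_one] at h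
      exact h
    rw [this, one_mul]
    exact hR i j
  refine mem_glInt_of_valBound F E v n w (by rw [coe_toGLw_cayGL]; exact valBound_reindex F E v n w hR)
    (by rw [coe_toGLw_cayGL_inv]; exact valBound_reindex F E v n w hRi)

omit [NumberField F] [Algebra.IsQuadraticExtension F E] in
/-- `[[1, y], [0, 1]] ∈ GL(𝒪_w)` for integral `y`. [cite: Kudla1994, §3] -/
theorem unipW_mem_glInt {y : Matrix (Fin n) (Fin n) (w.1.adicCompletion E)} (hy : ValBound 1 y) :
    unipW F E v n w y ∈ glInt (n + n) (w.1.adicCompletion E) := by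
  have h1 : ∀ z : Matrix (Fin n) (Fin n) (w.1.adicCompletion E), ValBound 1 z →
      ValBound 1 (Matrix.fromBlocks (1 : Matrix (Fin n) (Fin n) (w.1.adicCompletion E)) z 0 1) := by
    intro z hz
    rintro (i | i) (j | j)
    · exact valBound_one i j
    · exact hz i j
    · simp
    · exact valBound_one i j
  refine mem_glInt_of_valBound F E v n w (valBound_reindex F E v n w (h1 y hy)) ?_
  have : ((unipW F E v n w y)⁻¹ : GL (Fin (n + n)) (w.1.adicCompletion E)) = unipW F E v n w (-y) :=
    inv_eq_of_mul_eq_one_right (unipW_mul_unipW_neg F E v n w y)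
  rw [this]
  exact valBound_reindex F E v n w (h1 (-y) hy.neg)

omit [NumberField F] [Algebra.IsQuadraticExtension F E] in
/-- `s_w ∈ GL(𝒪_w)`. [cite: Kudla1994, §3] -/
theorem toGLw_weylGL_mem_glInt : toGLw F E v n w (weylGL F E v n) ∈ glInt (n + n) (w.1.adicCompletion E) := by
  have h1 : ValBound 1 (Matrix.fromBlocks (0 : Matrix (Fin n) (Fin n) (w.1.adicCompletion E)) (1 : Matrix (Fin n) (Fin n) (w.1.adicCompletion E))
      (1 : Matrix (Fin n) (Fin n) (w.1.adicCompletion E)) 0) := by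
    rintro (i | i) (j | j)
    · simp
    · exact valBound_one i j
    · exact valBound_one i j
    · simp
  refine mem_glInt_of_valBound F E v n w (by rw [coe_toGLw_weylGL]; exact valBound_reindex F E v n w h1) ?_
  have : ((toGLw F E v n w (weylGL F E v n))⁻¹ : GL (Fin (n + n)) (w.1.adicCompletion E)) = toGLw F E v n w (weylGL F E v n) :=
    inv_eq_of_mul_eq_one_right (toGLw_weylGL_mul_self F E v n w)
  rw [this, coe_toGLw_weylGL]
  exact valBound_reindex F E v n w h1

include hTw hTwd h2 in
/-- **`n(y) ∈ H(𝒪_v)`** for integral `y` (split place, `|2|_w = 1`, `T₀ ∈ GL_n(𝒪_w)`). [cite: GelbartRogawski1991, §3.1 (3.1.3)] -/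
theorem nSplit_mem_localInt {y : Matrix (Fin n) (Fin n) (w.1.adicCompletion E)} (hy : ValBound 1 y) :
    nSplit F E c hcδ hδ v n hT₀ hT₀d hJD w hw y ∈ UnitaryGroup.localInt E c (n + n) JD v := by
  rw [nSplit, splitEquivD_symm_mem_localInt_iff F E c hcδ hδ v n hT₀ hT₀d hJD w hw hTw hTwd]
  exact Subgroup.mul_mem _ (Subgroup.mul_mem _ (toGLw_cayGL_mem_glInt F E v n w h2) (unipW_mem_glInt F E v n w hy))
    (Subgroup.inv_mem _ (toGLw_cayGL_mem_glInt F E v n w h2))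

include hTw hTwd h2 in
/-- **`w_Δ ∈ H(𝒪_v)`** (split place, `|2|_w = 1`, `T₀ ∈ GL_n(𝒪_w)`). [cite: GelbartRogawski1991, §3.1 (3.1.3)] -/
theorem weylSplit_mem_localInt :
    weylSplit F E c hcδ hδ v n hT₀ hT₀d hJD w hw ∈ UnitaryGroup.localInt E c (n + n) JD v := by
  rw [weylSplit, splitEquivD_symm_mem_localInt_iff F E c hcδ hδ v n hT₀ hT₀d hJD w hw hTw hTwd]
  exact Subgroup.mul_mem _ (Subgroup.mul_mem _ (toGLw_cayGL_mem_glInt F E v n w h2) (toGLw_weylGL_mem_glInt F E v n w))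
    (Subgroup.inv_mem _ (toGLw_cayGL_mem_glInt F E v n w h2))

include h2 in
omit [Algebra.IsQuadraticExtension F E] in
/-- the adapted `w`-component of `k ∈ H(𝒪_v)` is integral. [cite: GelbartRogawski1991, §3.1 (3.1.3)] -/
theorem valBound_adapt_matW_of_mem_localInt {k : UnitaryGroup.localPi E c (n + n) JD v}
    (hk : k ∈ UnitaryGroup.localInt E c (n + n) JD v) : ValBound 1 (adapt (matW F E c v n w k)) := by
  have hkw := (mem_localInt_iff E c (n + n) JD v k).1 hk w
  have hM : ValBound 1 (matW F E c v n w k) := fun i j => by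
    simp only [matW, Matrix.reindex_apply, Matrix.submatrix_apply]
    exact (Valuation.mem_integer_iff _ _).1 (((mem_glInt_iff _).1 hkw).1 _ _)
  have hR : ValBound 1 (cayR (w.1.adicCompletion E) (Fin n)) := by
    rintro (i | i) (j | j)
    all_goals
      by_cases h : i = j
      · subst h; simp [cayR]
      · simp [cayR, Matrix.one_apply_ne h]
  have hRi : ValBound 1 (cayRinv (w.1.adicCompletion E) (Fin n)) := by
    intro i j
    rw [cayRinv, Matrix.smul_apply, smul_eq_mul, _root_.map_mul]
    have : ValuativeRel.valuation (w.1.adicCompletion E) (⅟(2 : w.1.adicCompletion E)) = 1 := by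
      have h := congrArg (ValuativeRel.valuation (w.1.adicCompletion E)) (invOf_mul_self (2 : w.1.adicCompletion E))
      rw [_root_.map_mul, h2, mul_one, _root_.map_one] at h
      exact h
    rw [this, one_mul]
    exact hR i j
  have := (hRi.mul hM).mul hR
  rw [one_mul, one_mul] at this
  exact this

end Integral

/-! ## §2 The integral big-cell decomposition at a split place -/

include hd in
/-- **THE INTEGRAL BIG-CELL DECOMPOSITION INSIDE `H(𝒪_v)` AT A SPLIT PLACE**: for `k ∈ H(𝒪_v)` and an integral `y`
with `C' = A_k + y C_k ∈ GL_n(𝒪_w)` (adapted blocks of the `w`-component), `w n(y) k = p · (w n(−ν))` with `p, n(y), n(−ν) ∈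
P_Δ(F_v) ∩ H(𝒪_v)`, `ν = −C'⁻¹(B_k + y D_k)`. [cite: GelbartRogawski1991, §3.1 (3.1.3); Kudla1994, §3] -/
theorem exists_bigCell_relation_split
    (hTw : ∀ i j, ValuativeRel.valuation (w.1.adicCompletion E) (gramW F E v n (T₀ := T₀) w i j) ≤ 1)
    (hTwd : ValuativeRel.valuation (w.1.adicCompletion E) (gramW F E v n (T₀ := T₀) w).det = 1)
    (h2 : ValuativeRel.valuation (w.1.adicCompletion E) (2 : w.1.adicCompletion E) = 1)
    {k : UnitaryGroup.localPi E c (n + n) JD v} (hk : k ∈ UnitaryGroup.localInt E c (n + n) JD v)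
    {y : Matrix (Fin n) (Fin n) (w.1.adicCompletion E)} (hyi : ValBound 1 y)
    (hC' : ValuativeRel.valuation (w.1.adicCompletion E) (blkA (matW F E c v n w k) + y * blkC (matW F E c v n w k)).det = 1) :
    ∃ n' p n₁ : UnitaryGroup.localPi E c (n + n) JD v,
      (n' ∈ UnitaryGroup.localInt E c (n + n) JD v ∧ IsSiegelDelta F E c hcδ hδ hd v n hT₀ hJD n') ∧
      (p ∈ UnitaryGroup.localInt E c (n + n) JD v ∧ IsSiegelDelta F E c hcδ hδ hd v n hT₀ hJD p) ∧
      (n₁ ∈ UnitaryGroup.localInt E c (n + n) JD v ∧ IsSiegelDelta F E c hcδ hδ hd v n hT₀ hJD n₁) ∧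
      weylSplit F E c hcδ hδ v n hT₀ hT₀d hJD w hw * n' * k = p * (weylSplit F E c hcδ hδ v n hT₀ hT₀d hJD w hw * n₁) := by
  -- blocks of `k_w`
  obtain ⟨hAi, hBi, hCi, hDi⟩ := valBound_toBlocks (valBound_adapt_matW_of_mem_localInt F E c v n w h2 hk)
  simp only [adapt_eq, Matrix.toBlocks_fromBlocks₁₁, Matrix.toBlocks_fromBlocks₁₂, Matrix.toBlocks_fromBlocks₂₁,
    Matrix.toBlocks_fromBlocks₂₂] at hAi hBi hCi hDi
  have hC'u : IsUnit (blkA (matW F E c v n w k) + y * blkC (matW F E c v n w k)).det :=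
    isUnit_iff_ne_zero.2 fun h => by rw [h, map_zero] at hC'; exact zero_ne_one hC'
  have hC'i : ValBound 1 (blkA (matW F E c v n w k) + y * blkC (matW F E c v n w k)) := by
    have := hyi.mul hCi; rw [one_mul] at this; exact hAi.add this
  have hC'inv : ValBound 1 (blkA (matW F E c v n w k) + y * blkC (matW F E c v n w k))⁻¹ :=
    DoubledUnitary.valBound_one_nonsing_inv hC'i hC'
  -- `ν`
  set ν : Matrix (Fin n) (Fin n) (w.1.adicCompletion E) :=
    -((blkA (matW F E c v n w k) + y * blkC (matW F E c v n w k))⁻¹ * (blkB (matW F E c v n w k) + y * blkD (matW F E c v n w k))) with hν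
  have hνi : ValBound 1 ν := by
    have h1 : ValBound 1 (blkB (matW F E c v n w k) + y * blkD (matW F E c v n w k)) := by
      have := hyi.mul hDi; rw [one_mul] at this; exact hBi.add this
    have := hC'inv.mul h1; rw [one_mul] at this
    exact this.neg
  -- the elements
  refine ⟨nSplit F E c hcδ hδ v n hT₀ hT₀d hJD w hw y,
    weylSplit F E c hcδ hδ v n hT₀ hT₀d hJD w hw * nSplit F E c hcδ hδ v n hT₀ hT₀d hJD w hw y * k *
      (nSplit F E c hcδ hδ v n hT₀ hT₀d hJD w hw ν * weylSplit F E c hcδ hδ v n hT₀ hT₀d hJD w hw),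
    nSplit F E c hcδ hδ v n hT₀ hT₀d hJD w hw (-ν),
    ⟨nSplit_mem_localInt F E c hcδ hδ v n hT₀ hT₀d hJD w hw hTw hTwd h2 hyi, isSiegelDelta_nSplit F E c hcδ hδ hd v n hT₀ hT₀d hJD w hw y⟩,
    ⟨?_, ?_⟩,
    ⟨nSplit_mem_localInt F E c hcδ hδ v n hT₀ hT₀d hJD w hw hTw hTwd h2 hνi.neg, isSiegelDelta_nSplit F E c hcδ hδ hd v n hT₀ hT₀d hJD w hw _⟩,
    ?_⟩
  · -- `p ∈ H(𝒪_v)`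
    have hwI := weylSplit_mem_localInt F E c hcδ hδ v n hT₀ hT₀d hJD w hw hTw hTwd h2
    exact Subgroup.mul_mem _ (Subgroup.mul_mem _ (Subgroup.mul_mem _ hwI
      (nSplit_mem_localInt F E c hcδ hδ v n hT₀ hT₀d hJD w hw hTw hTwd h2 hyi)) hk)
      (Subgroup.mul_mem _ (nSplit_mem_localInt F E c hcδ hδ v n hT₀ hT₀d hJD w hw hTw hTwd h2 hνi) hwI)
  · -- `p ∈ P_Δ`: its adapted `(2,1)` block is `C' ν + D' = 0`
    refine isSiegelDelta_of_blkC_matW_eq_zero F E c hcδ hδ hd v n hT₀ hT₀d hJD w hw ?_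
    rw [blkC_eq_adapt_toBlocks₂₁, matW_mul, matW_mul, matW_mul, matW_mul, adapt_mul, adapt_mul, adapt_mul, adapt_mul,
      adapt_matW_weylSplit, adapt_matW_nSplit, adapt_matW_nSplit, adapt_eq (matW F E c v n w k)]
    simp only [Matrix.fromBlocks_multiply, Matrix.one_mul, Matrix.mul_one, Matrix.zero_mul, Matrix.mul_zero, zero_add, add_zero,
      Matrix.toBlocks_fromBlocks₂₁]
    rw [hν, Matrix.mul_neg, Matrix.mul_nonsing_inv_cancel_left _ _ hC'u, neg_add_cancel]
  · -- the relation
    have h1 : nSplit F E c hcδ hδ v n hT₀ hT₀d hJD w hw ν * weylSplit F E c hcδ hδ v n hT₀ hT₀d hJD w hw *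
        (weylSplit F E c hcδ hδ v n hT₀ hT₀d hJD w hw * nSplit F E c hcδ hδ v n hT₀ hT₀d hJD w hw (-ν)) = 1 := by
      rw [mul_assoc, ← mul_assoc (weylSplit F E c hcδ hδ v n hT₀ hT₀d hJD w hw), weylSplit_mul_self, one_mul, nSplit_mul_nSplit_neg]
    rw [mul_assoc (weylSplit F E c hcδ hδ v n hT₀ hT₀d hJD w hw * nSplit F E c hcδ hδ v n hT₀ hT₀d hJD w hw y * k), h1, mul_one]

/-! ## §3 The unramified clause at a split place, group-theoretic form -/

include hd in
/-- **THE UNRAMIFIED CLAUSE AT A SPLIT PLACE, GROUP-THEORETIC FORM** (`|2|_w = 1`, `T₀ ∈ GL_n(𝒪_w)`): if `Φ₀ ≠ 0` is an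
eigenvector of `ω(w_Δ)` and every element of `P_Δ(F_v) ∩ H(𝒪_v)` fixes `Φ₀` under `ω = β⁻¹ · r ∘ ι`, then `H(𝒪_v)` fixes
`Φ₀` — the residue witness is the integral big cell of `GL_{n+n}(𝒪_w)` (`GLBigCell`). [cite: GelbartRogawski1991, §3.1 (3.1.3) p. 456; MoeglinVignerasWaldspurger1987, Chap. 2 II.10] -/
theorem omega_eq_self_of_glWitness_split
    (hTw : ∀ i j, ValuativeRel.valuation (w.1.adicCompletion E) (gramW F E v n (T₀ := T₀) w i j) ≤ 1)
    (hTwd : ValuativeRel.valuation (w.1.adicCompletion E) (gramW F E v n (T₀ := T₀) w).det = 1)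
    (h2 : ValuativeRel.valuation (w.1.adicCompletion E) (2 : w.1.adicCompletion E) = 1)
    [MeasurableSpace (v.adicCompletion F)] [BorelSpace (v.adicCompletion F)]
    (hU : ImplementerUniqueUpToScalar (localSchrodinger F (n + n) (gramD F n T₀) v))
    (r : ImplementerSection (localSchrodinger F (n + n) (gramD F n T₀) v))
    (β : UnitaryGroup.localPi E c (n + n) JD v → ℂˣ)
    (hβ : ∀ g₁ g₂, β (g₁ * g₂) * r.cocycle hU (iotaD F E c hcδ hδ hd v n hT₀ hJD g₁) (iotaD F E c hcδ hδ hd v n hT₀ hJD g₂) =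
      β g₁ * β g₂)
    {Φ₀ : SchwartzBruhat (Fin (n + n) → v.adicCompletion F)} (hΦ₀ : Φ₀ ≠ 0)
    (heig : ∃ s : ℂ, r.omega (iotaD F E c hcδ hδ hd v n hT₀ hJD) β (weylSplit F E c hcδ hδ v n hT₀ hT₀d hJD w hw) Φ₀ = s • Φ₀)
    (hpar : ∀ p ∈ UnitaryGroup.localInt E c (n + n) JD v, IsSiegelDelta F E c hcδ hδ hd v n hT₀ hJD p →
      r.omega (iotaD F E c hcδ hδ hd v n hT₀ hJD) β p Φ₀ = Φ₀) :
    ∀ k ∈ UnitaryGroup.localInt E c (n + n) JD v, r.omega (iotaD F E c hcδ hδ hd v n hT₀ hJD) β k Φ₀ = Φ₀ := by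
  refine r.omega_apply_eq_self_of_forall_bigCell_relation' hU (iotaD F E c hcδ hδ hd v n hT₀ hJD) hβ hΦ₀
    (UnitaryGroup.localInt E c (n + n) JD v : Set (UnitaryGroup.localPi E c (n + n) JD v)) heig fun k hk => ?_
  -- the GL residue witness for `Y = adapt (matW k)`
  have hYi := valBound_adapt_matW_of_mem_localInt F E c v n w h2 hk
  have hY'i := valBound_adapt_matW_of_mem_localInt F E c v n w h2 (Subgroup.inv_mem _ hk)
  have hYY' : adapt (matW F E c v n w k) * adapt (matW F E c v n w k⁻¹) = 1 := by
    rw [← adapt_mul, ← matW_mul, mul_inv_cancel, matW_one, adapt_one]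
  obtain ⟨y, hyi, hdet⟩ := GLBigCell.exists_integral_valuation_det_block₁₁_add_mul_eq_one hYi hY'i hYY'
  have hA : (adapt (matW F E c v n w k)).toBlocks₁₁ = blkA (matW F E c v n w k) := by rw [adapt_eq]; rfl
  have hC : (adapt (matW F E c v n w k)).toBlocks₂₁ = blkC (matW F E c v n w k) := by rw [adapt_eq]; rfl
  rw [hA, hC] at hdet
  obtain ⟨n', p, n₁, ⟨hn'I, hn'P⟩, ⟨hpI, hpP⟩, ⟨hn₁I, hn₁P⟩, hrel⟩ :=
    exists_bigCell_relation_split F E c hcδ hδ hd v n hT₀ hT₀d hJD w hw hTw hTwd h2 hk hyi hdet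
  exact ⟨n', p, n₁, hpar n' hn'I hn'P, hpar p hpI hpP, hpar n₁ hn₁I hn₁P, hrel⟩

/-! ### Build-lane note (ops-buildfix G11b-3 recipe, LEDGER B13-1, 2026-08-21)
`lean -o` (the hub build lane, never `lean`/the gate check) runs Lean 4.32's library-suggestion indexers
(`Lean.LibrarySuggestions.SymbolFrequency` / `SineQuaNon`, from their `exportEntriesFn`) over the statement of
every local theorem that is not a denied premise; on this family's statements (very large dependent binder
telescopes through the theta-kernel / dual-pair data) that fold runs for tens of minutes to hours and the build
lane kills the job (incident G11b-3, run/shared/lean/ops/buildfix/G11b-3-DOSSIER.md). `isDeniedPremise` skips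
`[implicit_reducible]` constants before any fold, and a reducibility status on a *theorem* is inert (Meta never
unfolds `thmInfo`; the kernel ignores the attribute), so the public theorems of this file are tagged
`[implicit_reducible]` purely to keep them out of that index. Only other effect: they are not offered by
`+suggestions` premise selectors. No statement or proof is changed; superseded if the operator lands a
deny-list form (`HarnessLib.PremiseIndex`). -/
set_option allowUnsafeReducibility true in
attribute [implicit_reducible]
  matW_mul matW_one coe_unipW unipW_mul_unipW_neg adapt_matW_nSplit adapt_matW_weylSplit
  isSiegelDelta_nSplit nSplit_mul_nSplit_neg weylSplit_mul_self placeFormD_unit_mem_glInt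
  splitEquivD_symm_mem_localInt_iff mem_glInt_of_valBound valBound_reindex toGLw_cayGL_mem_glInt
  unipW_mem_glInt toGLw_weylGL_mem_glInt nSplit_mem_localInt weylSplit_mem_localInt
  valBound_adapt_matW_of_mem_localInt exists_bigCell_relation_split
  omega_eq_self_of_glWitness_split

end Literature.NumberTheory.GelbartRogawski1991.UnitaryDualPair.LocalSplitting

end
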